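import Mathlib
import Summits.Parity.BatemanHorn.Theorems.IsogenyRedeiTypeIMainTermSubsetAlgebra
import Summits.Parity.BatemanHorn.Theorems.IsogenyRedeiTypeIMainTermLocalCounts
import HarnessLib

/-!
# Type-I main term for Bateman–Horn (stmt-Parity-0873), input B2 (part 2):
# the `Λ_k`-valued arithmetic function `𝒶` of the singular series and its multiplicativity

For a system `f : Fin k → ℤ[X]`:

* `sysDensity f d = ρ(d)/lcm(d)` (`G(d)`), multiplicative over tuples with coprime supports;
* `cWeight f d = G(d) · ∏_i (μ(d_i) + ε_i μ(d_i) log d_i) ∈ Λ_k`, likewise multiplicative;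
* `sum_finMulAntidiag_mul_of_coprime` — for `(m, n) = 1` the tuples with product `mn` are the
  pointwise products of the tuples with products `m` and `n` (the bijection `e ↦ ((e_i, m))_i`,
  `((e_i, n))_i`), so a tuple-multiplicative weight pushes forward to a multiplicative arithmetic
  function (`isMultiplicative_pushforward`);
* `aFun f` — `𝒶(m) = ∑_{d_1⋯d_k = m} cWeight f d`, a multiplicative `ArithmeticFunction (SAlg k)`
  whose top coefficient is the coefficient
  `a(m) = ∑_{d_1⋯d_k = m} G(d) ∏_i μ(d_i) log d_i` of the log-weighted singular series
  (`coeff_univ_aFun`).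

Everything here is proved.
-/

noncomputable section

open Finset Polynomial ArithmeticFunction
open scoped ArithmeticFunction.Moebius

namespace Summit.Parity.BatemanHorn.Theorems.TypeIMainTerm

variable {k : ℕ}

/-! ### Tuples with coprime supports: the bijection `finMulAntidiag k m × finMulAntidiag k n ≃ finMulAntidiag k (mn)` -/

/-- For `(m, n) = 1`, `a ∣ m`, `b ∣ n`: `gcd(ab, m) = a`. -/
theorem gcd_mul_eq_left_of_dvd {m n a b : ℕ} (hmn : Nat.Coprime m n) (ha : a ∣ m) (hb : b ∣ n) :
    Nat.gcd (a * b) m = a := by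
  have hbm : Nat.Coprime b m := Nat.Coprime.coprime_dvd_left hb hmn.symm
  rw [Nat.Coprime.gcd_mul_right_cancel _ hbm, Nat.gcd_eq_left ha]

/-- For `(m, n) = 1`, `m, n > 0` and a tuple `e` with `∏ e_i = mn`:
`∏_i gcd(e_i, m) = m` and `∏_i gcd(e_i, n) = n`. -/
theorem prod_gcd_eq_of_prod_eq {m n : ℕ} (hm : 0 < m) (hmn : Nat.Coprime m n)
    (e : Fin k → ℕ) (he : ∏ i, e i = m * n) :
    ∏ i, Nat.gcd (e i) m = m ∧ ∏ i, Nat.gcd (e i) n = n := by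
  set P := ∏ i, Nat.gcd (e i) m with hP
  set Q := ∏ i, Nat.gcd (e i) n with hQ
  have hPQ : P * Q = m * n := by
    rw [hP, hQ, ← Finset.prod_mul_distrib, ← he]
    refine Finset.prod_congr rfl fun i _ => ?_
    rw [← Nat.Coprime.gcd_mul _ hmn]
    exact Nat.gcd_eq_left (he ▸ Finset.dvd_prod_of_mem e (Finset.mem_univ i))
  have hPn : Nat.Coprime P n :=
    Nat.Coprime.prod_left fun i _ => Nat.Coprime.coprime_dvd_left (Nat.gcd_dvd_right _ _) hmn
  have hQm : Nat.Coprime Q m :=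
    Nat.Coprime.prod_left fun i _ => Nat.Coprime.coprime_dvd_left (Nat.gcd_dvd_right _ _) hmn.symm
  have hPm : P = m := by
    refine Nat.dvd_antisymm ?_ ?_
    · exact hPn.dvd_of_dvd_mul_right ⟨Q, hPQ.symm⟩
    · exact hQm.symm.dvd_of_dvd_mul_right ⟨n, hPQ⟩
  refine ⟨hPm, ?_⟩
  rw [hPm] at hPQ
  exact Nat.eq_of_mul_eq_mul_left hm hPQ

/-- **Tuples with product `mn`, `(m,n) = 1`, are the pointwise products of tuples with products
`m` and `n`**: `∑_{∏ e = mn} c(e) = ∑_{∏ d = m} ∑_{∏ d' = n} c(d d')`. -/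
theorem sum_finMulAntidiag_mul_of_coprime {R : Type*} [AddCommMonoid R] (c : (Fin k → ℕ) → R)
    {m n : ℕ} (hm : 0 < m) (hn : 0 < n) (hmn : Nat.Coprime m n) :
    ∑ e ∈ Nat.finMulAntidiag k (m * n), c e =
      ∑ p ∈ Nat.finMulAntidiag k m ×ˢ Nat.finMulAntidiag k n, c (p.1 * p.2) := by
  refine Finset.sum_nbij' (fun e => (fun i => Nat.gcd (e i) m, fun i => Nat.gcd (e i) n))
    (fun p => p.1 * p.2) ?_ ?_ ?_ ?_ ?_
  · intro e he
    rw [Nat.mem_finMulAntidiag] at he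
    obtain ⟨h1, h2⟩ := prod_gcd_eq_of_prod_eq hm hmn e he.1
    rw [Finset.mem_product, Nat.mem_finMulAntidiag, Nat.mem_finMulAntidiag]
    exact ⟨⟨h1, hm.ne'⟩, ⟨h2, hn.ne'⟩⟩
  · rintro ⟨d, d'⟩ hp
    rw [Finset.mem_product, Nat.mem_finMulAntidiag, Nat.mem_finMulAntidiag] at hp
    rw [Nat.mem_finMulAntidiag]
    refine ⟨?_, Nat.mul_ne_zero hp.1.2 hp.2.2⟩
    simp only [Pi.mul_apply, Finset.prod_mul_distrib, hp.1.1, hp.2.1]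
  · intro e he
    rw [Nat.mem_finMulAntidiag] at he
    funext i
    simp only [Pi.mul_apply]
    rw [← Nat.Coprime.gcd_mul _ hmn]
    exact Nat.gcd_eq_left (he.1 ▸ Finset.dvd_prod_of_mem e (Finset.mem_univ i))
  · rintro ⟨d, d'⟩ hp
    rw [Finset.mem_product, Nat.mem_finMulAntidiag, Nat.mem_finMulAntidiag] at hp
    have hd : ∀ i, d i ∣ m := fun i => hp.1.1 ▸ Finset.dvd_prod_of_mem d (Finset.mem_univ i)
    have hd' : ∀ i, d' i ∣ n := fun i => hp.2.1 ▸ Finset.dvd_prod_of_mem d' (Finset.mem_univ i)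
    simp only [Pi.mul_apply, Prod.mk.injEq]
    constructor
    · funext i; exact gcd_mul_eq_left_of_dvd hmn (hd i) (hd' i)
    · funext i; rw [mul_comm]; exact gcd_mul_eq_left_of_dvd hmn.symm (hd' i) (hd i)
  · intro e he
    rw [Nat.mem_finMulAntidiag] at he
    congr 1
    funext i
    simp only [Pi.mul_apply]
    rw [← Nat.Coprime.gcd_mul _ hmn]
    exact (Nat.gcd_eq_left (he.1 ▸ Finset.dvd_prod_of_mem e (Finset.mem_univ i))).symm

/-- **Pushforward of a tuple-multiplicative weight is multiplicative.** If `c(1) = 1` and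
`c(dd') = c(d)c(d')` whenever `(∏ d_i, ∏ d'_i) = 1`, then `m ↦ ∑_{∏ d = m} c(d)` is a
multiplicative arithmetic function. -/
theorem isMultiplicative_pushforward {R : Type*} [CommSemiring R] (c : (Fin k → ℕ) → R)
    (h1 : c (fun _ => 1) = 1)
    (hmul : ∀ d d' : Fin k → ℕ, Nat.Coprime (∏ i, d i) (∏ i, d' i) → c (d * d') = c d * c d') :
    ArithmeticFunction.IsMultiplicative
      (⟨fun m => ∑ d ∈ Nat.finMulAntidiag k m, c d, by simp⟩ : ArithmeticFunction R) := by
  refine ⟨?_, ?_⟩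
  · simp [Nat.finMulAntidiag_one, h1]
  · intro m n hmn
    simp only [ArithmeticFunction.coe_mk]
    rcases Nat.eq_zero_or_pos m with rfl | hm
    · simp
    rcases Nat.eq_zero_or_pos n with rfl | hn
    · simp
    rw [sum_finMulAntidiag_mul_of_coprime c hm hn hmn, Finset.sum_product, Finset.sum_mul_sum]
    refine Finset.sum_congr rfl fun d hd => Finset.sum_congr rfl fun d' hd' => ?_
    rw [Nat.mem_finMulAntidiag] at hd hd'
    exact hmul d d' (by rw [hd.1, hd'.1]; exact hmn)

/-! ### The density `G(d)` and the weight `cWeight` -/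

variable (f : Fin k → ℤ[X])

/-- `sysDensity f (d * d') = sysDensity f d * sysDensity f d'`. -/
theorem sysDensity_mul {d d' : Fin k → ℕ} (hcop : Nat.Coprime (∏ i, d i) (∏ i, d' i)) :
    sysDensity f (d * d') = sysDensity f d * sysDensity f d' := by
  unfold sysDensity
  rw [sysCount_mul f hcop, tupleLcm_mul hcop]
  push_cast
  rw [mul_div_mul_comm]

/-- `0 ≤ sysDensity f d`. -/
theorem sysDensity_nonneg (d : Fin k → ℕ) : 0 ≤ sysDensity f d := by
  unfold sysDensity; positivity

/-- `sysDensity f d ≤ 1`. -/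
theorem sysDensity_le_one (d : Fin k → ℕ) : sysDensity f d ≤ 1 := by
  unfold sysDensity sysCount
  rcases Nat.eq_zero_or_pos (tupleLcm d) with h | h
  · rw [h]; simp
  · rw [div_le_one (by exact_mod_cast h)]
    exact_mod_cast (Finset.card_le_card (sysSols_subset f d _)).trans (Finset.card_range _).le

/-- `sysDensity f (fun _ => 1) = 1`. -/
theorem sysDensity_one : sysDensity f (fun _ => 1) = 1 := by
  unfold sysDensity sysCount
  have hL : tupleLcm (fun _ : Fin k => 1) = 1 := by
    refine Nat.dvd_antisymm (Finset.lcm_dvd fun i _ => dvd_refl 1) (one_dvd _)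
  rw [hL, Finset.range_one]
  have : sysSols f (fun _ => 1) {0} = {0} := by
    refine Finset.Subset.antisymm (sysSols_subset f _ _) fun n hn => ?_
    rw [mem_sysSols]; exact ⟨hn, fun i => by simp⟩
  rw [this]; simp

/-- `moebLin i 1 = (1 : SAlg k)`. -/
theorem moebLin_one (i : Fin k) : moebLin i 1 = (1 : SAlg k) := by
  unfold moebLin; simp [SAlg.lin_one_zero]

/-- `moebLin i (mn) = moebLin i m * moebLin i n` for coprime `m, n`. -/
theorem moebLin_mul_of_coprime (i : Fin k) {m n : ℕ} (h : Nat.Coprime m n) :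
    moebLin i (m * n) = moebLin i m * (moebLin i n : SAlg k) := by
  unfold moebLin
  rw [SAlg.lin_mul_lin, ArithmeticFunction.isMultiplicative_moebius.map_mul_of_coprime h]
  push_cast
  rcases Nat.eq_zero_or_pos m with rfl | hm
  · simp
  rcases Nat.eq_zero_or_pos n with rfl | hn
  · simp
  rw [Real.log_mul (by exact_mod_cast hm.ne') (by exact_mod_cast hn.ne')]
  congr 1; ring

/-- `cWeight f (fun _ => 1) = 1`. -/
theorem cWeight_one : cWeight f (fun _ => 1) = 1 := by
  unfold cWeight; rw [sysDensity_one, one_smul]; simp [moebLin_one]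

/-- **Tuple multiplicativity of the weight.** -/
theorem cWeight_mul {d d' : Fin k → ℕ} (hcop : Nat.Coprime (∏ i, d i) (∏ i, d' i)) :
    cWeight f (d * d') = cWeight f d * cWeight f d' := by
  have hci : ∀ i, Nat.Coprime (d i) (d' i) := fun i =>
    Nat.Coprime.of_dvd (Finset.dvd_prod_of_mem d (Finset.mem_univ i))
      (Finset.dvd_prod_of_mem d' (Finset.mem_univ i)) hcop
  unfold cWeight
  rw [sysDensity_mul f hcop, SAlg.smul_mul, SAlg.mul_smul', smul_smul, ← Finset.prod_mul_distrib]
  congr 1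
  exact Finset.prod_congr rfl fun i _ => moebLin_mul_of_coprime i (hci i)

/-! ### The arithmetic function `𝒶` -/

/-- `𝒶` is multiplicative. -/
theorem isMultiplicative_aFun : (aFun f).IsMultiplicative :=
  isMultiplicative_pushforward (cWeight f) (cWeight_one f) (fun _ _ h => cWeight_mul f h)

/-- **The top coefficient of `𝒶(m)` is the coefficient of the log-weighted singular series**:
`[ε_1⋯ε_k] 𝒶(m) = ∑_{d_1⋯d_k = m} G(d) ∏_i μ(d_i) log d_i`. -/
theorem coeff_univ_aFun (m : ℕ) :
    SAlg.coeff (aFun f m) Finset.univ =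
      ∑ d ∈ Nat.finMulAntidiag k m, sysDensity f d * ∏ i, ((μ (d i) : ℝ) * Real.log (d i)) := by
  rw [aFun_apply]
  -- `coeff · univ` is additive
  have hadd : ∀ (s : Finset (Fin k → ℕ)) (x : (Fin k → ℕ) → SAlg k),
      SAlg.coeff (∑ d ∈ s, x d) Finset.univ = ∑ d ∈ s, SAlg.coeff (x d) Finset.univ := by
    intro s x
    induction s using Finset.induction_on with
    | empty => simp
    | insert a s ha ih => rw [Finset.sum_insert ha, Finset.sum_insert ha, SAlg.coeff_add, ih]
  rw [hadd]
  refine Finset.sum_congr rfl fun d _ => ?_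
  unfold cWeight moebLin
  rw [SAlg.coeff_smul, SAlg.coeff_univ_prod_lin]

/-- The `∅`-component of `𝒶(m)`: `𝒶₀(m) = ∑_{d_1⋯d_k = m} G(d) ∏_i μ(d_i)`. -/
theorem coeff_empty_aFun (m : ℕ) :
    SAlg.coeff (aFun f m) ∅ = ∑ d ∈ Nat.finMulAntidiag k m, sysDensity f d * ∏ i, (μ (d i) : ℝ) := by
  rw [aFun_apply]
  have hadd : ∀ (s : Finset (Fin k → ℕ)) (x : (Fin k → ℕ) → SAlg k),
      SAlg.coeff (∑ d ∈ s, x d) ∅ = ∑ d ∈ s, SAlg.coeff (x d) ∅ := by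
    intro s x
    induction s using Finset.induction_on with
    | empty => simp
    | insert a s ha ih => rw [Finset.sum_insert ha, Finset.sum_insert ha, SAlg.coeff_add, ih]
  rw [hadd]
  refine Finset.sum_congr rfl fun d _ => ?_
  unfold cWeight moebLin
  rw [SAlg.coeff_smul]
  have h := SAlg.coeff_empty_mul_prod_lin (1 : SAlg k) (fun i => (μ (d i) : ℝ))
    (fun i => (μ (d i) : ℝ) * Real.log (d i))
  rw [one_mul, SAlg.coeff_empty_one, mul_one] at h
  rw [h]

end Summit.Parity.BatemanHorn.Theorems.TypeIMainTerm

end
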